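import Literature.Analysis.SpecialFunctions.DigammaStirlingSeries
import HarnessLib

/-!
# Format C, design C∞: `ψ(¼ + iy)` expanded in powers of `1/(4y)` to ANY order, with an explicit remainder

Route context: Fourier–Galerkin / Schur-complement certificates of Weil positivity on a window ("format C";
cell memo `run/shared/lean/pub/rh-explicit/rh-explicit-weil-10/KERNEL-LEVER.md` §20; supporting stmt-RiemannHypothesis-0098;
seat rh-explicit-weil-10).  The archimedean families of the C∞ images (`J_s`, `J_c`, `WeilFormatCMixedArchAsymptotics`) and the
rows' mode function involve `ψ(¼ + iω_m/2)`; to fold their deviations from `π/4`, `½ log` into the pure-power families of the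
structured tail (weil-2 gen9's `famexp` design) the data side needs `ψ(¼ + iy)` as a polynomial in `t = 1/(4y)` with explicit
coefficients and an explicit remainder of any prescribed order.  From the tree's Stirling series
(`Literature.….norm_digamma_sub_stirlingSeries_le`, any `ν`) at `w = ¼ + iy = iy(1 − it)`, Mathlib's binomial–geometric series
(`hasSum_choose_mul_geometric_of_norm_lt_one`) for `w^{−j} = (−4it)^j(1 − it)^{−j}` and the logarithmic series
(`Complex.norm_log_sub_logTaylor_le`) for `Log w = log y + iπ/2 + Log(1 − it)`:

* `norm_inv_one_sub_pow_sub_sum_le` — `‖(1 − r)^{−(k+1)} − Σ_{n≤N} C(n+k,k) rⁿ‖ ≤ 2^{k+1}(2‖r‖)^{N+1}` for `‖r‖ ≤ ¼`;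
* `log_quarter_add_mul_I` — `Log(¼ + iy) = log y + (π/2)i + Log(1 − i/(4y))` (`y > 0`);
* `norm_log_one_sub_add_sum_le` — `‖Log(1 − it) + Σ_{n=1}^{K} (it)ⁿ/n‖ ≤ t^{K+1}/((K+1)(1−t))`;
* **`norm_digamma_quarter_sub_expansion_le`** — for `y ≥ 1`, `ν ≥ 1`, `K ≥ 2ν`, `t = 1/(4y)`:
  `‖ψ(¼+iy) − (log y + (π/2)i − Σ_{n=1}^{K} (it)ⁿ/n + 2Σ_{n<K} (it)^{n+1}`
  `            − Σ_{k=1}^{ν} (B_{2k}/(2k))·16^k·Σ_{n≤K−2k} C(n+2k−1, 2k−1)(it)^{n+2k})‖`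
  `  ≤ (4π²/3)(2ν+1)!/(2π)^{2ν+1}·(4t)^{2ν} + t^{K+1}/((K+1)(1−t)) + 2t^{K+1} + Σ_{k=1}^{ν} |B_{2k}/(2k)|·2^{K+1+4k}·t^{K+1}`
  (the pieces are kept separate; real and imaginary parts follow from `(it)ⁿ = iⁿtⁿ`).

Pure analysis; standard axioms; no definitions; no RH claim.
-/

set_option autoImplicit false
-- `Summit.RiemannHypothesis.RiemannHypothesis.…` is the layout-mandated namespace (summit = problem name).
set_option linter.dupNamespace false

noncomputable section

open Complex Filter Finset
open scoped Real Topology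

namespace Summit.RiemannHypothesis.RiemannHypothesis.Theorems.WeilFormatC

/-! ## Binomial–geometric tails -/

/-- **Truncated binomial–geometric series**: for `‖r‖ ≤ ¼`,
`‖1/(1 − r)^{k+1} − Σ_{n≤N} C(n+k,k) rⁿ‖ ≤ 2^{k+1}(2‖r‖)^{N+1}` (`C(m,k) ≤ 2^m`, geometric majorant). -/
theorem norm_inv_one_sub_pow_sub_sum_le {r : ℂ} (hr : ‖r‖ ≤ 1 / 4) (k N : ℕ) :
    ‖1 / (1 - r) ^ (k + 1) - ∑ n ∈ Finset.range (N + 1), ((n + k).choose k : ℂ) * r ^ n‖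
      ≤ 2 ^ (k + 1) * (2 * ‖r‖) ^ (N + 1) := by
  have hr1 : ‖r‖ < 1 := lt_of_le_of_lt hr (by norm_num)
  have hs := hasSum_choose_mul_geometric_of_norm_lt_one k hr1
  -- the tail as a shifted series
  have htail : 1 / (1 - r) ^ (k + 1) - ∑ n ∈ Finset.range (N + 1), ((n + k).choose k : ℂ) * r ^ n
      = ∑' n : ℕ, ((n + (N + 1) + k).choose k : ℂ) * r ^ (n + (N + 1)) := by
    rw [← hs.tsum_eq, ← hs.summable.sum_add_tsum_nat_add (N + 1)]
    ring
  rw [htail]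
  -- majorant `2^{n+N+1+k} ‖r‖^{n+N+1}`
  have h2r : 2 * ‖r‖ < 1 := by linarith
  have h2r0 : 0 ≤ 2 * ‖r‖ := by positivity
  have hmaj : ∀ n : ℕ, ‖((n + (N + 1) + k).choose k : ℂ) * r ^ (n + (N + 1))‖
      ≤ 2 ^ k * (2 * ‖r‖) ^ (N + 1) * (2 * ‖r‖) ^ n := by
    intro n
    rw [norm_mul, norm_pow, Complex.norm_natCast]
    have hc : ((n + (N + 1) + k).choose k : ℝ) ≤ 2 ^ (n + (N + 1) + k) := by
      exact_mod_cast Nat.choose_le_two_pow _ _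
    calc ((n + (N + 1) + k).choose k : ℝ) * ‖r‖ ^ (n + (N + 1))
        ≤ 2 ^ (n + (N + 1) + k) * ‖r‖ ^ (n + (N + 1)) :=
          mul_le_mul_of_nonneg_right hc (by positivity)
      _ = 2 ^ k * (2 * ‖r‖) ^ (N + 1) * (2 * ‖r‖) ^ n := by rw [mul_pow, mul_pow]; ring
  have hgeo : HasSum (fun n : ℕ ↦ 2 ^ k * (2 * ‖r‖) ^ (N + 1) * (2 * ‖r‖) ^ n)
      (2 ^ k * (2 * ‖r‖) ^ (N + 1) * (1 - 2 * ‖r‖)⁻¹) :=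
    (hasSum_geometric_of_lt_one h2r0 h2r).mul_left _
  have hsn : Summable fun n : ℕ ↦ ‖((n + (N + 1) + k).choose k : ℂ) * r ^ (n + (N + 1))‖ :=
    Summable.of_nonneg_of_le (fun n ↦ norm_nonneg _) hmaj hgeo.summable
  calc ‖∑' n : ℕ, ((n + (N + 1) + k).choose k : ℂ) * r ^ (n + (N + 1))‖
      ≤ ∑' n : ℕ, ‖((n + (N + 1) + k).choose k : ℂ) * r ^ (n + (N + 1))‖ := norm_tsum_le_tsum_norm hsn
    _ ≤ ∑' n : ℕ, 2 ^ k * (2 * ‖r‖) ^ (N + 1) * (2 * ‖r‖) ^ n := hsn.tsum_le_tsum hmaj hgeo.summable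
    _ = 2 ^ k * (2 * ‖r‖) ^ (N + 1) * (1 - 2 * ‖r‖)⁻¹ := hgeo.tsum_eq
    _ ≤ 2 ^ k * (2 * ‖r‖) ^ (N + 1) * 2 := by
        refine mul_le_mul_of_nonneg_left ?_ (by positivity)
        rw [inv_le_comm₀ (by linarith) (by norm_num)]
        linarith
    _ = 2 ^ (k + 1) * (2 * ‖r‖) ^ (N + 1) := by rw [pow_succ]; ring

/-! ## The logarithm on the quarter line -/

/-- **`Log(¼ + iy) = log y + (π/2)i + Log(1 − i/(4y))`** for `y > 0`. -/
theorem log_quarter_add_mul_I {y : ℝ} (hy : 0 < y) :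
    Complex.log (1 / 4 + (y : ℂ) * I)
      = (Real.log y : ℂ) + ((π / 2 : ℝ) : ℂ) * I + Complex.log (1 - I * ((1 / (4 * y) : ℝ) : ℂ)) := by
  have hy0 : (y : ℂ) ≠ 0 := by exact_mod_cast hy.ne'
  have hyt : (y : ℂ) * ((1 / (4 * y) : ℝ) : ℂ) = 1 / 4 := by
    push_cast
    field_simp
  -- `¼ + iy = (iy)·(1 − i/(4y))`
  have hprod : (1 / 4 : ℂ) + (y : ℂ) * I = ((y : ℂ) * I) * (1 - I * ((1 / (4 * y) : ℝ) : ℂ)) := by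
    rw [mul_sub, mul_one, show (y : ℂ) * I * (I * ((1 / (4 * y) : ℝ) : ℂ))
        = (I * I) * ((y : ℂ) * ((1 / (4 * y) : ℝ) : ℂ)) by ring, Complex.I_mul_I, hyt]
    ring
  -- `Log(iy) = log y + (π/2) i`
  have hlogiy : Complex.log ((y : ℂ) * I) = (Real.log y : ℂ) + ((π / 2 : ℝ) : ℂ) * I := by
    rw [Complex.log_ofReal_mul hy I_ne_zero, Complex.log_I]
    push_cast
    ring
  -- the sum of the two logarithms has imaginary part in `(−π, π]`, so it is THE logarithm of the product
  set S : ℂ := Complex.log ((y : ℂ) * I) + Complex.log (1 - I * ((1 / (4 * y) : ℝ) : ℂ)) with hS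
  have hre : (0 : ℝ) < (1 - I * ((1 / (4 * y) : ℝ) : ℂ)).re := by simp
  have harg : |Complex.arg (1 - I * ((1 / (4 * y) : ℝ) : ℂ))| < π / 2 :=
    Complex.abs_arg_lt_pi_div_two_iff.2 (Or.inl hre)
  have hSim : S.im = π / 2 + Complex.arg (1 - I * ((1 / (4 * y) : ℝ) : ℂ)) := by
    rw [hS, Complex.add_im, hlogiy, Complex.log_im]
    simp
  have h1 : -π < S.im := by
    rw [hSim]; have := (abs_lt.1 harg).1; linarith [Real.pi_pos]
  have h2 : S.im ≤ π := by
    rw [hSim]; have := (abs_lt.1 harg).2; linarith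
  have hne1 : (y : ℂ) * I ≠ 0 := mul_ne_zero hy0 I_ne_zero
  have hne2 : (1 - I * ((1 / (4 * y) : ℝ) : ℂ)) ≠ 0 := by
    intro h; rw [h] at hre; simp at hre
  have hexp : Complex.exp S = (1 / 4 : ℂ) + (y : ℂ) * I := by
    rw [hS, Complex.exp_add, Complex.exp_log hne1, Complex.exp_log hne2, hprod]
  calc Complex.log (1 / 4 + (y : ℂ) * I) = Complex.log (Complex.exp S) := by rw [hexp]
    _ = S := Complex.log_exp h1 h2
    _ = (Real.log y : ℂ) + ((π / 2 : ℝ) : ℂ) * I + Complex.log (1 - I * ((1 / (4 * y) : ℝ) : ℂ)) := by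
        rw [hS, hlogiy]

/-- **The logarithmic series on the quarter line**: for `0 ≤ t < 1`,
`‖Log(1 − it) + Σ_{n=1}^{K} (it)ⁿ/n‖ ≤ t^{K+1}/((K+1)(1−t))`. -/
theorem norm_log_one_sub_add_sum_le {t : ℝ} (ht0 : 0 ≤ t) (ht1 : t < 1) (K : ℕ) :
    ‖Complex.log (1 - I * (t : ℂ)) + ∑ n ∈ Finset.Icc 1 K, (I * t) ^ n / (n : ℂ)‖
      ≤ t ^ (K + 1) / ((K + 1) * (1 - t)) := by
  have hnorm : ‖(-(I * (t : ℂ)))‖ = t := by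
    rw [norm_neg, norm_mul, Complex.norm_I, one_mul, Complex.norm_real, Real.norm_of_nonneg ht0]
  have hz : ‖(-(I * (t : ℂ)))‖ < 1 := by rw [hnorm]; exact ht1
  have h := Complex.norm_log_sub_logTaylor_le K hz
  rw [hnorm] at h
  -- `logTaylor (K+1) (−it) = −Σ_{n=1}^{K} (it)ⁿ/n`
  have hT : Complex.logTaylor (K + 1) (-(I * (t : ℂ))) = -∑ n ∈ Finset.Icc 1 K, (I * t) ^ n / (n : ℂ) := by
    rw [Complex.logTaylor, Finset.range_eq_Ico, ← Finset.sum_neg_distrib]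
    have hsplit : Finset.Ico 0 (K + 1) = insert 0 (Finset.Icc 1 K) := by
      ext n; simp only [Finset.mem_Ico, Finset.mem_insert, Finset.mem_Icc]; omega
    rw [hsplit, Finset.sum_insert (by simp)]
    simp only [zero_add, pow_zero, Nat.cast_zero, div_zero, mul_one]
    refine Finset.sum_congr rfl fun n _ ↦ ?_
    have e : ((-1 : ℂ)) ^ (n + 1) * ((-1) ^ n * (I * (t : ℂ)) ^ n) = -((I * (t : ℂ)) ^ n) := by
      rw [pow_succ, show ((-1 : ℂ)) ^ n * (-1) * ((-1) ^ n * (I * (t : ℂ)) ^ n)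
          = ((-1) ^ n * (-1) ^ n) * (-1) * (I * (t : ℂ)) ^ n by ring, ← mul_pow, neg_one_mul, neg_neg, one_pow]
      ring
    rw [neg_pow (I * (t : ℂ)) n, e, neg_div]
  rw [show (1 : ℂ) - I * t = 1 + -(I * (t : ℂ)) by ring]
  rw [hT, sub_neg_eq_add] at h
  calc ‖Complex.log (1 + -(I * (t : ℂ))) + ∑ n ∈ Finset.Icc 1 K, (I * t) ^ n / (n : ℂ)‖
      ≤ t ^ (K + 1) * (1 - t)⁻¹ / (K + 1) := h
    _ = t ^ (K + 1) / ((K + 1) * (1 - t)) := by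
        rw [div_eq_mul_inv, div_eq_mul_inv, mul_inv]; ring

/-! ## The expansion -/

/-- **`ψ(¼ + iy)` in powers of `t = 1/(4y)`, any order, explicit remainder** (`y ≥ 1`, `ν ≥ 1`, `2ν ≤ K`).  See the module
docstring; the four remainder terms are: Stirling (`(4π²/3)(2ν+1)!/(2π)^{2ν+1}·(4t)^{2ν}`), logarithm, `−1/(2w)`, and the
Bernoulli terms `B_{2k}/(2k w^{2k})`. -/
theorem norm_digamma_quarter_sub_expansion_le {y : ℝ} (hy : 1 ≤ y) {ν : ℕ} (hν : ν ≠ 0) {K : ℕ} (hK : 2 * ν ≤ K) :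
    ‖Complex.digamma (1 / 4 + (y : ℂ) * I)
        - ((Real.log y : ℂ) + ((π / 2 : ℝ) : ℂ) * I
            - ∑ n ∈ Finset.Icc 1 K, (I * ((1 / (4 * y) : ℝ) : ℂ)) ^ n / (n : ℂ)
            + 2 * ∑ n ∈ Finset.range K, (I * ((1 / (4 * y) : ℝ) : ℂ)) ^ (n + 1)
            - ∑ k ∈ Finset.Icc 1 ν, (bernoulli (2 * k) : ℂ) / (2 * k) * 16 ^ k *
                ∑ n ∈ Finset.range (K - 2 * k + 1), ((n + (2 * k - 1)).choose (2 * k - 1) : ℂ) *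
                  (I * ((1 / (4 * y) : ℝ) : ℂ)) ^ (n + 2 * k))‖
      ≤ 4 * Real.pi ^ 2 / 3 * ((2 * ν + 1).factorial : ℝ) / (2 * Real.pi) ^ (2 * ν + 1) * (4 * (1 / (4 * y))) ^ (2 * ν)
        + (1 / (4 * y)) ^ (K + 1) / ((K + 1) * (1 - 1 / (4 * y)))
        + 2 * (1 / (4 * y)) ^ (K + 1)
        + ∑ k ∈ Finset.Icc 1 ν, |(bernoulli (2 * k) : ℝ) / (2 * k)| * 2 ^ (K + 1 + 4 * k) * (1 / (4 * y)) ^ (K + 1) := by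
  have hy0 : 0 < y := by linarith
  set t : ℝ := 1 / (4 * y) with ht
  have ht0 : 0 < t := by positivity
  have ht4 : t ≤ 1 / 4 := by
    rw [ht, div_le_div_iff₀ (by positivity) (by norm_num)]; linarith
  have ht1 : t < 1 := by linarith
  set w : ℂ := 1 / 4 + (y : ℂ) * I with hw
  have hwre : w.re = 1 / 4 := by simp [hw]
  have hwim : w.im = y := by simp [hw]
  set r : ℂ := I * (t : ℂ) with hr
  have hrnorm : ‖r‖ = t := by
    rw [hr, norm_mul, Complex.norm_I, one_mul, Complex.norm_real, Real.norm_of_nonneg ht0.le]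
  have hr4 : ‖r‖ ≤ 1 / 4 := hrnorm ▸ ht4
  have hr1 : ‖r‖ < 1 := hrnorm ▸ ht1
  have h1r : (1 : ℂ) - r ≠ 0 := by
    intro h
    have : ‖(1 : ℂ)‖ = ‖r‖ := by rw [sub_eq_zero.1 h]
    rw [norm_one] at this; linarith
  -- `w = (iy)(1 − r)`, `1/w = −4r/(1 − r)`
  have hy0' : (y : ℂ) ≠ 0 := by exact_mod_cast hy0.ne'
  have hyt : (y : ℂ) * (t : ℂ) = 1 / 4 := by rw [ht]; push_cast; field_simp
  have hw_eq : w = ((y : ℂ) * I) * (1 - r) := by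
    rw [hw, hr, mul_sub, mul_one, show (y : ℂ) * I * (I * (t : ℂ)) = (I * I) * ((y : ℂ) * (t : ℂ)) by ring,
      Complex.I_mul_I, hyt]
    ring
  have hyI : (y : ℂ) * I ≠ 0 := mul_ne_zero hy0' I_ne_zero
  have hw0 : w ≠ 0 := by rw [hw_eq]; exact mul_ne_zero hyI h1r
  have hinvyI : 1 / ((y : ℂ) * I) = -4 * r := by
    have e : ((y : ℂ) * I) * (-4 * r) = 1 := by
      rw [hr, show (y : ℂ) * I * (-4 * (I * (t : ℂ))) = -4 * (I * I) * ((y : ℂ) * (t : ℂ)) by ring, Complex.I_mul_I, hyt]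
      norm_num
    exact (eq_one_div_of_mul_eq_one_right e).symm
  have hinv : 1 / w = -4 * r * (1 / (1 - r)) := by
    rw [hw_eq, ← one_div_mul_one_div, hinvyI]
  -- (P0) Stirling at `w`
  have hSt := Literature.Analysis.SpecialFunctions.Complex.norm_digamma_sub_stirlingSeries_le (w := w)
    (by rw [hwre]; norm_num) hν
  have hnormw : y ≤ ‖w‖ := by
    have := Complex.abs_im_le_norm w
    rw [hwim, abs_of_pos hy0] at this
    exact this
  have hwn : 0 < ‖w‖ := lt_of_lt_of_le hy0 hnormw
  have hSt' : Real.pi ^ 2 / 3 * ((2 * ν + 1).factorial : ℝ) / (2 * Real.pi) ^ (2 * ν + 1) / (‖w‖ ^ (2 * ν) * w.re)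
      ≤ 4 * Real.pi ^ 2 / 3 * ((2 * ν + 1).factorial : ℝ) / (2 * Real.pi) ^ (2 * ν + 1) * (4 * t) ^ (2 * ν) := by
    have h4t : 4 * t = 1 / y := by rw [ht]; field_simp
    rw [hwre, h4t, one_div_pow]
    have hyw : y ^ (2 * ν) ≤ ‖w‖ ^ (2 * ν) := pow_le_pow_left₀ hy0.le hnormw _
    have hy2 : 0 < y ^ (2 * ν) := by positivity
    set S : ℝ := Real.pi ^ 2 / 3 * ((2 * ν + 1).factorial : ℝ) / (2 * Real.pi) ^ (2 * ν + 1) with hS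
    have hS0 : 0 < S := by positivity
    calc S / (‖w‖ ^ (2 * ν) * (1 / 4)) = 4 * S / ‖w‖ ^ (2 * ν) := by
          field_simp
      _ ≤ 4 * S / y ^ (2 * ν) := div_le_div_of_nonneg_left (by positivity) hy2 hyw
      _ = 4 * Real.pi ^ 2 / 3 * ((2 * ν + 1).factorial : ℝ) / (2 * Real.pi) ^ (2 * ν + 1) * (1 / y ^ (2 * ν)) := by
          rw [hS]; ring
  -- (P1) the logarithm
  have hlog : Complex.log w = (Real.log y : ℂ) + ((π / 2 : ℝ) : ℂ) * I + Complex.log (1 - r) := by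
    rw [hw, log_quarter_add_mul_I hy0, hr, ht]
  have hR1 := norm_log_one_sub_add_sum_le ht0.le ht1 K
  -- (P2) `−1/(2w) − 2Σ_{n<K} r^{n+1} = 2 r^{K+1}/(1 − r)`
  have hgeom := hasSum_geometric_of_norm_lt_one hr1
  have e2 : (1 : ℂ) / (1 - r) = ∑ n ∈ Finset.range K, r ^ n + r ^ K * (1 / (1 - r)) := by
    have h1 := hgeom.summable.sum_add_tsum_nat_add K
    have h2 : ∑' n : ℕ, r ^ (n + K) = r ^ K * ∑' n : ℕ, r ^ n := by
      rw [← tsum_mul_left]; exact tsum_congr fun n ↦ by rw [pow_add]; ring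
    rw [h2, hgeom.tsum_eq] at h1
    rw [one_div]
    exact h1.symm
  have hP2 : -(1 / (2 * w)) - 2 * ∑ n ∈ Finset.range K, r ^ (n + 1) = 2 * r ^ (K + 1) * (1 / (1 - r)) := by
    have e1 : -(1 / (2 * w)) = 2 * r * (1 / (1 - r)) := by
      rw [← one_div_mul_one_div, hinv]; ring
    have e3 : 2 * r * (1 / (1 - r)) = 2 * ∑ n ∈ Finset.range K, r ^ (n + 1) + 2 * r ^ (K + 1) * (1 / (1 - r)) := by
      conv_lhs => rw [e2]
      rw [mul_add, Finset.mul_sum, Finset.mul_sum]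
      congr 1
      · exact Finset.sum_congr rfl fun n _ ↦ by rw [pow_succ]; ring
      · rw [pow_succ]; ring
    rw [e1, e3]; ring
  have hC : ‖-(1 / (2 * w)) - 2 * ∑ n ∈ Finset.range K, r ^ (n + 1)‖ ≤ 2 * t ^ (K + 1) := by
    rw [hP2]
    have h1mr : 1 ≤ ‖(1 : ℂ) - r‖ := by
      have e : ((1 : ℂ) - r).re = 1 := by simp [hr]
      calc (1 : ℝ) = |((1 : ℂ) - r).re| := by rw [e, abs_one]
        _ ≤ ‖(1 : ℂ) - r‖ := Complex.abs_re_le_norm _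
    rw [norm_mul, norm_mul, norm_pow, hrnorm, norm_div, norm_one]
    have h2 : ‖(2 : ℂ)‖ = 2 := by norm_num
    rw [h2]
    calc 2 * t ^ (K + 1) * (1 / ‖(1 : ℂ) - r‖) ≤ 2 * t ^ (K + 1) * 1 := by
          refine mul_le_mul_of_nonneg_left ?_ (by positivity)
          rw [div_le_one (by linarith)]; exact h1mr
      _ = 2 * t ^ (K + 1) := mul_one _
  -- (P3) the Bernoulli terms
  have hP3 : ∀ k ∈ Finset.Icc 1 ν,
      ‖(bernoulli (2 * k) : ℂ) / (2 * k) / w ^ (2 * k)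
        - (bernoulli (2 * k) : ℂ) / (2 * k) * 16 ^ k *
            ∑ n ∈ Finset.range (K - 2 * k + 1), ((n + (2 * k - 1)).choose (2 * k - 1) : ℂ) * r ^ (n + 2 * k)‖
      ≤ |(bernoulli (2 * k) : ℝ) / (2 * k)| * 2 ^ (K + 1 + 4 * k) * t ^ (K + 1) := by
    intro k hk
    have hk1 : 1 ≤ k := (Finset.mem_Icc.1 hk).1
    have hkν : k ≤ ν := (Finset.mem_Icc.1 hk).2
    have h2k : 2 * k - 1 + 1 = 2 * k := by omega
    -- `1/w^{2k} = 16^k r^{2k} · 1/(1−r)^{2k}`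
    have hwpow : (1 : ℂ) / w ^ (2 * k) = 16 ^ k * r ^ (2 * k) * (1 / (1 - r) ^ (2 * k)) := by
      rw [← one_div_pow, hinv, mul_pow, mul_pow, one_div_pow]
      congr 1
      rw [show ((-4 : ℂ)) ^ (2 * k) = 16 ^ k by rw [pow_mul]; norm_num]
    have hbin := norm_inv_one_sub_pow_sub_sum_le hr4 (2 * k - 1) (K - 2 * k)
    rw [h2k, hrnorm] at hbin
    have e : (bernoulli (2 * k) : ℂ) / (2 * k) / w ^ (2 * k)
        - (bernoulli (2 * k) : ℂ) / (2 * k) * 16 ^ k *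
            ∑ n ∈ Finset.range (K - 2 * k + 1), ((n + (2 * k - 1)).choose (2 * k - 1) : ℂ) * r ^ (n + 2 * k)
        = (bernoulli (2 * k) : ℂ) / (2 * k) * 16 ^ k * r ^ (2 * k) *
            (1 / (1 - r) ^ (2 * k)
              - ∑ n ∈ Finset.range (K - 2 * k + 1), ((n + (2 * k - 1)).choose (2 * k - 1) : ℂ) * r ^ n) := by
      rw [div_eq_mul_one_div _ (w ^ (2 * k)), hwpow, mul_sub, Finset.mul_sum, Finset.mul_sum]
      congr 1
      · ring
      · exact Finset.sum_congr rfl fun n _ ↦ by rw [pow_add]; ring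
    have hb : ‖(bernoulli (2 * k) : ℂ) / (2 * k)‖ = |(bernoulli (2 * k) : ℝ) / (2 * k)| := by
      rw [show (bernoulli (2 * k) : ℂ) / (2 * k) = (((bernoulli (2 * k) : ℝ) / (2 * k) : ℝ) : ℂ) by push_cast; ring,
        Complex.norm_real, Real.norm_eq_abs]
    have h16 : ‖(16 : ℂ)‖ = 16 := by norm_num
    rw [e, norm_mul, norm_mul, norm_mul, norm_pow, norm_pow, hrnorm, hb, h16]
    calc |(bernoulli (2 * k) : ℝ) / (2 * k)| * 16 ^ k * t ^ (2 * k) *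
          ‖1 / (1 - r) ^ (2 * k) - ∑ n ∈ Finset.range (K - 2 * k + 1), ((n + (2 * k - 1)).choose (2 * k - 1) : ℂ) * r ^ n‖
        ≤ |(bernoulli (2 * k) : ℝ) / (2 * k)| * 16 ^ k * t ^ (2 * k) * (2 ^ (2 * k) * (2 * t) ^ (K - 2 * k + 1)) :=
          mul_le_mul_of_nonneg_left hbin (by positivity)
      _ = |(bernoulli (2 * k) : ℝ) / (2 * k)| * 2 ^ (K + 1 + 4 * k) * t ^ (K + 1) := by
          rw [mul_pow, show (16 : ℝ) ^ k = 2 ^ (4 * k) by rw [pow_mul]; norm_num]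
          have et : t ^ (2 * k) * t ^ (K - 2 * k + 1) = t ^ (K + 1) := by
            rw [← pow_add]; congr 1; omega
          have e2 : (2 : ℝ) ^ (4 * k) * (2 ^ (2 * k) * 2 ^ (K - 2 * k + 1)) = 2 ^ (K + 1 + 4 * k) := by
            rw [← pow_add, ← pow_add]; congr 1; omega
          calc |(bernoulli (2 * k) : ℝ) / (2 * k)| * 2 ^ (4 * k) * t ^ (2 * k)
                * (2 ^ (2 * k) * (2 ^ (K - 2 * k + 1) * t ^ (K - 2 * k + 1)))
              = |(bernoulli (2 * k) : ℝ) / (2 * k)| * (2 ^ (4 * k) * (2 ^ (2 * k) * 2 ^ (K - 2 * k + 1)))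
                  * (t ^ (2 * k) * t ^ (K - 2 * k + 1)) := by ring
            _ = |(bernoulli (2 * k) : ℝ) / (2 * k)| * 2 ^ (K + 1 + 4 * k) * t ^ (K + 1) := by rw [et, e2]
  have hD := (norm_sum_le (Finset.Icc 1 ν) _).trans (Finset.sum_le_sum hP3)
  -- assemble
  have hdecomp : Complex.digamma w
      - ((Real.log y : ℂ) + ((π / 2 : ℝ) : ℂ) * I - ∑ n ∈ Finset.Icc 1 K, r ^ n / (n : ℂ)
          + 2 * ∑ n ∈ Finset.range K, r ^ (n + 1)
          - ∑ k ∈ Finset.Icc 1 ν, (bernoulli (2 * k) : ℂ) / (2 * k) * 16 ^ k *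
              ∑ n ∈ Finset.range (K - 2 * k + 1), ((n + (2 * k - 1)).choose (2 * k - 1) : ℂ) * r ^ (n + 2 * k))
      = (Complex.digamma w - (Complex.log w - 1 / (2 * w)
          - ∑ k ∈ Finset.Icc 1 ν, (bernoulli (2 * k) : ℂ) / (2 * k) / w ^ (2 * k)))
        + (Complex.log (1 - r) + ∑ n ∈ Finset.Icc 1 K, r ^ n / (n : ℂ))
        + (-(1 / (2 * w)) - 2 * ∑ n ∈ Finset.range K, r ^ (n + 1))
        - ∑ k ∈ Finset.Icc 1 ν, ((bernoulli (2 * k) : ℂ) / (2 * k) / w ^ (2 * k)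
            - (bernoulli (2 * k) : ℂ) / (2 * k) * 16 ^ k *
              ∑ n ∈ Finset.range (K - 2 * k + 1), ((n + (2 * k - 1)).choose (2 * k - 1) : ℂ) * r ^ (n + 2 * k)) := by
    rw [hlog, Finset.sum_sub_distrib]; ring
  rw [hdecomp]
  have hA := hSt.trans hSt'
  calc ‖(Complex.digamma w - (Complex.log w - 1 / (2 * w)
          - ∑ k ∈ Finset.Icc 1 ν, (bernoulli (2 * k) : ℂ) / (2 * k) / w ^ (2 * k)))
        + (Complex.log (1 - r) + ∑ n ∈ Finset.Icc 1 K, r ^ n / (n : ℂ))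
        + (-(1 / (2 * w)) - 2 * ∑ n ∈ Finset.range K, r ^ (n + 1))
        - ∑ k ∈ Finset.Icc 1 ν, ((bernoulli (2 * k) : ℂ) / (2 * k) / w ^ (2 * k)
            - (bernoulli (2 * k) : ℂ) / (2 * k) * 16 ^ k *
              ∑ n ∈ Finset.range (K - 2 * k + 1), ((n + (2 * k - 1)).choose (2 * k - 1) : ℂ) * r ^ (n + 2 * k))‖
      ≤ ‖(Complex.digamma w - (Complex.log w - 1 / (2 * w)
          - ∑ k ∈ Finset.Icc 1 ν, (bernoulli (2 * k) : ℂ) / (2 * k) / w ^ (2 * k)))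
        + (Complex.log (1 - r) + ∑ n ∈ Finset.Icc 1 K, r ^ n / (n : ℂ))
        + (-(1 / (2 * w)) - 2 * ∑ n ∈ Finset.range K, r ^ (n + 1))‖
        + ‖∑ k ∈ Finset.Icc 1 ν, ((bernoulli (2 * k) : ℂ) / (2 * k) / w ^ (2 * k)
            - (bernoulli (2 * k) : ℂ) / (2 * k) * 16 ^ k *
              ∑ n ∈ Finset.range (K - 2 * k + 1), ((n + (2 * k - 1)).choose (2 * k - 1) : ℂ) * r ^ (n + 2 * k))‖ :=
        norm_sub_le _ _
    _ ≤ (‖Complex.digamma w - (Complex.log w - 1 / (2 * w)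
          - ∑ k ∈ Finset.Icc 1 ν, (bernoulli (2 * k) : ℂ) / (2 * k) / w ^ (2 * k))‖
        + ‖Complex.log (1 - r) + ∑ n ∈ Finset.Icc 1 K, r ^ n / (n : ℂ)‖
        + ‖-(1 / (2 * w)) - 2 * ∑ n ∈ Finset.range K, r ^ (n + 1)‖)
        + ‖∑ k ∈ Finset.Icc 1 ν, ((bernoulli (2 * k) : ℂ) / (2 * k) / w ^ (2 * k)
            - (bernoulli (2 * k) : ℂ) / (2 * k) * 16 ^ k *
              ∑ n ∈ Finset.range (K - 2 * k + 1), ((n + (2 * k - 1)).choose (2 * k - 1) : ℂ) * r ^ (n + 2 * k))‖ :=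
        add_le_add norm_add₃_le le_rfl
    _ ≤ _ := add_le_add (add_le_add (add_le_add hA hR1) hC) hD

-- Build note (lead ruling R14-3 append remedy, 2026-08-24): re-landed with byte-identical declarations to trigger the hub olean build.
end Summit.RiemannHypothesis.RiemannHypothesis.Theorems.WeilFormatC
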